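import Summits.FinalStateConjecture.FinalStateConjecture.Theorems.PhotonSphereChannelsChannelsResolveTameDevelopmentsRSchwarzschildEndFar
import Summits.FinalStateConjecture.FinalStateConjecture.Theorems.PhotonSphereChannelsChannelsResolveTameDevelopmentsRSchwarzschildEndHorizon
import Summits.FinalStateConjecture.FinalStateConjecture.Theorems.PhotonSphereChannelsChannelsResolveTameDevelopmentsRSchwarzschildTameBalls
import Literature.Geometry.Lorentzian.KerrRicciFlat
import HarnessLib

/-!
# Route PhotonSphereChannels · crux `ChannelsResolveTameDevelopmentsR` (K2R-T2, stmt-FinalStateConjecture-17430) —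
# the SCHWARZSCHILD END, V: assembly — an exact Schwarzschild black hole IS a tame, silent end with NONEMPTY
# horizon whose d.o.c. is an exact Kerr `(M, 0)` exterior (the horizon-side inhabitant of the hull interface)

Files I–IV (`…RSchwarzschildEndCausal/EndFar/EndHorizon/ClockProfile/RadialForm/TameFrame/BallChart/ClockMetric/
TameBalls`) assembled: on the ingoing Kerr–Schild patch `Kerr.spacetime M 0 r₁` (`0 < r₁ < 2M`) the end datum
`E = (M, R = 9M, C = 0, far = inclusion of the cylinder {r > 9M}, clock = t* + F(r))`, with `F` the
Painlevé–Gullstrand clock correction cut off beyond `9M` (file IV-a, `R_a = 8M`), is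

* a `(Λ, r₀)`-TAME END (`EndDatum.IsTameEnd`): vacuum (`Kerr.isRicciFlat_smoothMetric`), far chart an injective
  local diffeomorphism with far deviation `0` and future `∂₀`, smooth clock equal to `t*` on the cylinder, and
  clock-adapted centred tame balls at every point of the d.o.c. (file IV-f);
* SILENT (`EndDatum.IsSilent`: two-sided non-radiating, silent horizon, red-shifted with `κ₀ = 1/4M`; files II–III);
* with NONEMPTY future event horizon `{r = 2M}`, d.o.c. `{r > 2M}` an EXACT Kerr `(M, 0)` exterior (`IsKerrDoc`).

So BOTH branches of the hull dichotomies of line `dark-future-exactness` are inhabited (the flat end,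
`…RFlatTameEnd.lean`, and this one), and every horizon clause of the interface (`IsSilentHorizon`, `IsRedShifted`,
`IsColdHorizon`'s negation side, `IsHorizonHullElement` base points `∈ closure doc`) has a certified non-vacuous instance.
Statements: `Schw.exists_isTameEnd` (instance-hypothesis form) and `Schw.exists_tame_silent_schwarzschild`
(spacetime-quantified, `[Kerr.Facts]` discharged). No definitions.
References: M. T. Anderson (2004), Def. 1.1 [Anderson2004]; R. M. Wald, *General Relativity* (1984), §12.1, §12.5
[Wald1984]; K. Martel, E. Poisson, Am. J. Phys. 69 (2001) 476, §II [MartelPoisson2001]; R. P. Kerr, A. Schild (1965), §3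
[KerrSchild1965].
-/

noncomputable section
set_option maxSynthPendingDepth 3 -- nested operator types `E4 →L E4 →L E4 →L ℝ` (as in the tree files)
set_option linter.dupNamespace false -- `Summit.FinalStateConjecture.FinalStateConjecture.…` is the tree's layout

open TopologicalSpace Filter Topology Set Function Metric
open scoped ContDiff Topology Manifold ENNReal NNReal

namespace Summit.FinalStateConjecture.FinalStateConjecture.Theorems.TameHull.Schw

open Literature.Geometry.Lorentzian

/-- **An exact Schwarzschild black hole is a tame silent end with nonempty horizon and exactly-Kerr d.o.c.**
For `0 < M` and `0 < r₁ < 2M` there are `Λ`, `r₀` and an end datum `E` of the patch `Kerr.spacetime M 0 r₁` with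
`E.IsTameEnd Λ r₀`, `E.IsSilent`, `E.IsNonRadiating`, `E.horizon = {r = 2M} ≠ ∅`, `E.doc = {r > 2M}`,
`E.horizon ⊆ closure E.doc`, `IsKerrDoc _ E.doc M 0`, reference mass `E.M = M`. [cite: Anderson2004, Def. 1.1] -/
theorem exists_isTameEnd [Kerr.Facts] {M r₁ : ℝ} (hM : 0 < M) (hr₁ : 0 < r₁) (hr₂ : r₁ < 2 * M) :
    ∃ (Λ : ℝ≥0) (r₀ : ℝ) (E : EndDatum (Kerr.spacetime M 0 r₁ hM.le)), E.IsTameEnd Λ r₀ ∧ E.IsSilent ∧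
      E.IsNonRadiating ∧ E.horizon.Nonempty ∧ E.horizon = {x | Kerr.radius 0 x.1 = 2 * M} ∧
      E.doc = {x | 2 * M < Kerr.radius 0 x.1} ∧ E.horizon ⊆ closure E.doc ∧
      IsKerrDoc (Kerr.spacetime M 0 r₁ hM.le) E.doc M 0 ∧ E.M = M := by
  -- the clock profile with `R_a = 8M`, `R_b = 9M`
  obtain ⟨ψ, F, hψ, hF, hFψ, hF0, hψ0, hψPG, hψb⟩ :=
    exists_clockProfile M r₁ (8 * M) (9 * M) hM hr₁ (by linarith)
  have hle : r₁ ≤ 9 * M := by linarith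
  -- the end datum
  let E : EndDatum (Kerr.spacetime M 0 r₁ hM.le) :=
    ⟨M, 9 * M, 0, Opens.inclusion (Kerr.region_mono 0 hle), fun x ↦ x.1 0 + F (Kerr.radius 0 x.1)⟩
  have hfar : ∀ y, (E.far y).1 = y.1 := fun _ ↦ rfl
  have hclock : ∀ x, E.clock x = x.1 0 + F (Kerr.radius 0 x.1) := fun _ ↦ rfl
  have hEM : E.M = M := rfl
  have hER : 2 * M ≤ E.R := by show 2 * M ≤ 9 * M; linarith
  -- files II–III
  have hdoc := doc_eq_of_far E hfar hM hr₁ hr₂.le hER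
  have hhor := horizon_eq_of_far E hfar hM hr₁ hr₂.le hER
  have hnr := isNonRadiating_of_far E hfar hEM
  -- file IV-f: the tame balls
  obtain ⟨Λ, r₀, hr₀, htame⟩ := exists_tame_balls E hM hr₁ hr₂ hF hψ hFψ (Ra := 8 * M) (Rb := 9 * M) le_rfl
    (by linarith) hψPG hψ0 hψb hclock hdoc
  refine ⟨Λ, r₀, E, ?_, isSilent_of_horizon_eq E hM hhor hF hclock hnr, hnr,
    horizon_nonempty_of_far E hfar hM hr₁ hr₂ hER, hhor, hdoc, horizon_subset_closure_doc_of_far E hfar hM hr₁ hr₂.le hER,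
    isKerrDoc_doc_of_far E hfar hM hr₁ hr₂.le hER, hEM⟩
  exact
    { r₀_pos := hr₀
      mass_nonneg := hM.le
      lt_R := by show max (2 * M) 0 < 9 * M; rw [max_eq_left (by linarith)]; linarith
      vacuum := by
        intro h
        haveI : (Kerr.smoothMetric M 0 r₁).HasLeviCivita := h
        exact Kerr.isRicciFlat_smoothMetric M 0 r₁
      far_isLocalDiffeomorph := far_isLocalDiffeomorph_of_far E hfar
      far_injective := far_injective_of_far E hfar
      far_bound := far_bound_of_far E hfar hEM le_rfl
      far_future := far_future_of_far E hfar hER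
      clock_smooth := clock_smooth_of_radial E hF hclock
      clock_far := clock_far_of_radial E hfar hclock fun r hr ↦ hF0 r (le_of_lt hr)
      tame := htame }

/-- **The class of tame silent ends with a black hole is inhabited**, in the spacetime-quantified form of the hull
stubs, with every named-fact class discharged: for `0 < M`, `0 < r₁ < 2M` there are a spacetime (the Schwarzschild
Kerr–Schild patch `{r > r₁}`), `Λ`, `r₀` and `E` with `E.IsTameEnd Λ r₀ ∧ E.IsSilent ∧ E.horizon.Nonempty` and an EXACT
sub-extremal Kerr d.o.c. (`0 < M`, `|0| < M`). [cite: Anderson2004, Def. 1.1] -/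
theorem exists_tame_silent_schwarzschild : ∀ (M r₁ : ℝ), 0 < M → 0 < r₁ → r₁ < 2 * M → ∃ (𝓢 : Spacetime.{0} 4) (Λ : ℝ≥0) (r₀ : ℝ) (E : EndDatum 𝓢), E.IsTameEnd Λ r₀ ∧ E.IsSilent ∧ E.IsNonRadiating ∧ E.horizon.Nonempty ∧ E.horizon ⊆ closure E.doc ∧ ∃ M' a' : ℝ, 0 < M' ∧ |a'| < M' ∧ IsKerrDoc 𝓢 E.doc M' a' := by
  intro M r₁ hM hr₁ hr₂
  haveI : Kerr.Facts :=
    ⟨Kerr.isConnected_region_holds, Kerr.contMDiff_bilin_holds, Kerr.contMDiff_timeVector_holds⟩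
  obtain ⟨Λ, r₀, E, htame, hsil, hnr, hne, -, -, hcl, hK, -⟩ := exists_isTameEnd hM hr₁ hr₂
  exact ⟨_, Λ, r₀, E, htame, hsil, hnr, hne, hcl, M, 0, hM, by rw [abs_zero]; exact hM, hK⟩

end Summit.FinalStateConjecture.FinalStateConjecture.Theorems.TameHull.Schw

end
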